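import Mathlib
import Summits.NavierStokesRegularity.NavierStokesRegularity.Theses.UnthreadedDoor
import Literature.Analysis.FluidPDE.KNSSRemark61
import Literature.Analysis.FluidPDE.SuitableWeak
import Literature.Analysis.FluidPDE.LocalTypeI
import HarnessLib

/-!
# `UnthreadedDoor.ConstantSliceExtinction` — a Type-I ancient Oseen-mild profile with spatially
  constant slices is not backward singular at the apex
  (item stmt-NavierStokesRegularity-27409, crux rank 3 of route UnthreadedDoor)

**Statement (verbatim route decl).** A Type-I ancient Oseen-mild divergence-free profile on
`(−∞,0) × ℝ³` (`‖v(s,y)‖ ≤ C/√(−s)`, continuous on the open slab,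
`v(t) = e^{(t−s)Δ}v(s) − B_s(v,v)(t)` for all `s < t < 0`) all of whose slices are spatially
constant is not backward singular at `(0,0)`.

PROOF (the item's plan; every analytic input is a tree theorem). Write `v(t, ·) = b(t)` with
`b(t) := v(t, 0)`. KNSS 2009 Remark 6.1, PROVED in the tree as
`Literature.Analysis.FluidPDE.KNSS2009_remark61` (the heat extension of a constant is the constant,
`heatExtension_const`; the Oseen–Duhamel term of spatially constant slices vanishes because the Oseen
kernel is odd in the space variable, `oseenDuhamel_eq_zero_of_const` — so the docstring's Fubini worry
does not arise: `∫ K(τ, x − y)[b, b] dy = 0` holds unconditionally), gives `b(s) = b(t)` for all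
`s, t < 0`. The Type-I time decay `‖b(t)‖ = ‖b(s)‖ ≤ C/√(−s)` for every `s < 0` forces `b ≡ 0`
(take `√(−s) = max(C,0)/‖b(t)‖ + 1`). Hence `v ≡ 0` on the open past, so `v` is (essentially)
bounded — indeed zero — on the backward cylinder `Q_1(0,0) = (−1,0) × B_1`, contradicting
`IsBackwardSingularPoint v 0` (`‖v‖_{L^∞(Q_1)} = ⊤`). Continuity and the divergence-free clause are
not needed.

HONEST FRAMING: an elementary extinction lemma (item of a DRAFT door route); nothing here bears on
`PoloidalLiouville` (stmt-1222), on the door's `Target`, or on Navier–Stokes regularity — all OPEN.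
-/

noncomputable section

set_option linter.dupNamespace false

namespace Summit.NavierStokesRegularity.NavierStokesRegularity.Theorems

open MeasureTheory Set Filter Topology Metric Function
open Literature.Analysis Literature.Analysis.FluidPDE
open scoped ENNReal

/-- **Item stmt-NavierStokesRegularity-27409** (`UnthreadedDoor.ConstantSliceExtinction`): a Type-I
ancient Oseen-mild profile with spatially constant slices vanishes identically on the open past
(KNSS 2009 Remark 6.1 + the Type-I time decay), hence is not backward singular at the apex.
[cite: KochNadirashviliSereginSverak2009, Remark 6.1 (arXiv:0709.3599 p. 11)] -/
theorem unthreadedDoor_constantSliceExtinction_proof :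
    Summit.NavierStokesRegularity.NavierStokesRegularity.Theses.UnthreadedDoor.ConstantSliceExtinction := by
  unfold Summit.NavierStokesRegularity.NavierStokesRegularity.Theses.UnthreadedDoor.ConstantSliceExtinction
  intro C v hrate _hcont hmild _hdiv hconst hsing
  -- the slices are the constants `b(t) = v(t, 0)`
  have hub : ∀ t < 0, ∀ x, v t x = v t 0 := fun t ht x => by
    obtain ⟨b, hb⟩ := hconst t ht
    rw [hb x, hb 0]
  -- KNSS 2009, Remark 6.1: `b` is constant in time
  have hmild' : ∀ s t : ℝ, s < t → t < 0 →
      ∀ᵐ x ∂(volume : Measure (EuclideanSpace ℝ (Fin 3))),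
        v t x = UnboundedOperators.heatExtension (v s) (1 * (t - s)) x - oseenDuhamel 1 s v v t x :=
    fun s t hst ht => Eventually.of_forall fun x => by
      rw [one_mul]
      exact hmild s t hst ht x
  have hb : ∀ s t : ℝ, s < 0 → t < 0 → v s 0 = v t 0 :=
    KNSS2009_remark61 (b := fun t => v t 0) one_pos hub hmild'
  -- the Type-I time decay forces `b ≡ 0`, hence `v ≡ 0` on the open past
  have hzero : ∀ t < 0, ∀ x, v t x = 0 := by
    intro t ht x
    rw [hub t ht x]
    by_contra hne
    have ha : 0 < ‖v t 0‖ := norm_pos_iff.2 hne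
    set a : ℝ := ‖v t 0‖ with hadef
    set q : ℝ := max C 0 / a + 1 with hqdef
    have hq : 0 < q := by positivity
    have hs : -(q ^ 2) < (0 : ℝ) := by nlinarith
    have hdec := hrate (-(q ^ 2)) hs (0 : EuclideanSpace ℝ (Fin 3))
    rw [hb (-(q ^ 2)) t hs ht, neg_neg, Real.sqrt_sq hq.le] at hdec
    -- `C / q < a`
    have h1 : C / q ≤ max C 0 / q := div_le_div_of_nonneg_right (le_max_left _ _) hq.le
    have h2 : max C 0 / q < a := by
      rw [div_lt_iff₀ hq, hqdef, mul_add, mul_one, mul_div_cancel₀ _ ha.ne']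
      linarith
    linarith
  -- so `v` vanishes on the backward cylinder `Q_1(0,0)`: not a backward singular point
  have h1 := hsing 1 one_pos
  have hS : MeasurableSet
      (parabolicCylinder (1 : ℝ) (0 : ℝ × EuclideanSpace ℝ (Fin 3))) :=
    (isOpen_parabolicCylinder _ _).measurableSet
  have hae : (uncurry v) =ᵐ[volume.restrict
      (parabolicCylinder (1 : ℝ) (0 : ℝ × EuclideanSpace ℝ (Fin 3)))] 0 := by
    refine (ae_restrict_iff' hS).2 (Eventually.of_forall fun z hz => ?_)
    obtain ⟨s, y⟩ := z
    have hs : s < 0 := by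
      have := (mem_parabolicCylinder.1 hz).1.2
      simpa using this
    exact hzero s hs y
  rw [eLpNorm_congr_ae hae, eLpNorm_zero] at h1
  exact ENNReal.zero_ne_top h1

end Summit.NavierStokesRegularity.NavierStokesRegularity.Theorems

end
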